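import Literature.NumberTheory.GaloisCohomology.Howard2004.ResidualThetaReflectionProofs
import Literature.NumberTheory.GaloisCohomology.Howard2004.DVRSettingDatumChiProofs
import Literature.NumberTheory.GaloisCohomology.Howard2004.ResidualDualityDatumProofs
import Literature.NumberTheory.GaloisCohomology.Howard2004.DVRSettingLevelTrivialityProofs
import Literature.NumberTheory.GaloisCohomology.Howard2004.ResidualSelmerEigenpartsProofs
import Literature.NumberTheory.GaloisCohomology.Howard2004.DVRSettingChebotarevEigenclassesProofs
import Literature.NumberTheory.GaloisCohomology.Howard2004.ResidualLevelControlProofs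
import Literature.NumberTheory.GaloisCohomology.Howard2004.DVRSettingDatumLettersProofs
import Literature.NumberTheory.GaloisCohomology.Howard2004.InertEigenlinesProofs
import Literature.NumberTheory.GaloisCohomology.Howard2004.InertTransverseDecompositionProofs
import Literature.NumberTheory.GaloisCohomology.Howard2004.InertTransverseDecompositionOfUnitsProofs
import Literature.NumberTheory.GaloisCohomology.Howard2004.DVRSettingResidualLocalInputsProofs
import Literature.NumberTheory.GaloisCohomology.Howard2004.ResidualTateDualBijectiveProofs
import Literature.NumberTheory.GaloisCohomology.Howard2004.TransportTransverseProofs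
import Literature.NumberTheory.GaloisCohomology.Howard2004.TransverseScalarStableProofs
import HarnessLib

/-!
# R6 (RES-EIGLINES): the `τ_v`-eigenline letters of `H¹_tr(K_v, T̄)` and `H¹_ur(K_v, T̄)` at every engine prime, for
# every `DVRSetting` and EVERY conjugation datum (proofs file)

Topic `NumberTheory/GaloisCohomology/Howard2004`.  THEOREMS ONLY: no definition, no named fact, no instance,
no notation, no `sorry`.

B. Howard, *The Heegner point Kolyvagin system*, Compositio Math. **140** (2004) = arXiv:1202.6340, Lemma 1.5.3 (p. 10
L12–16: «one-dimensional eigenspaces»).  S-level instantiation of `InertEigenlinesProofs` (seat x10b-p1-w5 g8: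
`transverse_/unramified_eigen_decomposition_and_line`, `…_exists_eigenclass_ne_zero`) at `(S.ρbar, S.A k, S.cd, v)` for
`v ∈ 𝓛^{(2k−1)}`, with EVERY datum letter discharged: `hΘ := residual_hΘ` (this file: `ResidualTau.hΘ_of_duality` of
`ResidualThetaReflectionProofs` fed with `exists_residualDualityDatum` (H.4 + H.5(c)), H.5(a), `𝔪T̄ = 0`, `2 ∈ R_kˣ`,
`ρ̄(τ⁻¹δ_vτ · δ_v) = 1` on `T̄` and `χ(δ_v) = 1` in `R_k` (`datum_hχ`)), `hdih := datum_hdih`, `hφγ := datum_hφγ`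
(`DVRSettingDatumLettersProofs`), trivial local action (`toLocal_ρbar_apply_eq_self_…`),
`σ₀`/`hcyc`/`hkill` from a tame generator (`InertTameGeneratorRingClassProofs`, `InertTransverseDecompositionOfUnitsProofs`:
`ℓ + 1 ∣ #G_ℓ · #𝓞_K^×` under `p ∤ #𝓞_K^×`), `𝔪T̄ = 0`,
`2 ∈ R_kˣ`, `p`-primary, the `R_k`- and `τ_v`-stabilities (`TransverseScalarStable`, `TransportTransverse`, H.5(b)).
Outputs in the shapes of the GD-line assembly `DVRSettingEngineGDLineProofs.engine_gd_dich_of_letters` (x10b-p1-w8 g11), with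
`Lf = F̄ₖ (Sum.inr v)` (= `unramifiedSubgroup (GaloisRep.toLocal v S.ρbar) 1` by x9-p1-w3 g15's
`propagateStructure_cond_inr_eq_unramifiedSubgroup_of_mem_L`, `DVRSettingResidualLocalInputsProofs`) and `Lt = transverseStructure p S.ρbar S.jbar (Sum.inr v)`:

* `DVRSetting.rhobar_conj_delta_mul_delta_apply`, `DVRSetting.residual_hΘ` — `ρ̄(τ⁻¹δ_vτ · δ_v) = 1` on `T̄` and the
  letter `hΘ` (`Θ_v = θ ∘ ρ̄(δ_v)` is a reflection of `T̄`) at every engine prime, for every datum;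
* `DVRSetting.exists_sigma0_residual`, `DVRSetting.residual_local_letters` — the local letters at `T̄`;
* `DVRSetting.residual_hdect` / `residual_hlinet` / `residual_hwitt` (transverse side);
* `DVRSetting.residual_hdecf` / `residual_hlinef` / `residual_hwitf` (unramified side);
* `DVRSetting.residual_eigenline_letters` — the six letters bundled, `(S hy k hu)`.

Units binder (transverse side only): `hu : ¬ p ∣ Nat.card (𝓞 K)ˣ` (Howard's exact obstruction; for `d_K < −4` it is
`not_dvd_card_units_of_discr_lt`).  The unramified side is `hu`-free.
Cell `pub/bsd-print-x9`, G87 (print leaf `stub_h161` of stmt-BirchSwinnertonDyer-22642); seat `bsd-line-x10b-p1-w5` g9.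
NOT HERE: R7-final; `thm161_dvrKolyvaginBound` is NOT proved; no summit statement is proved; BSD is not proved by any of this.

References: [Howard2004HeegnerKolyvagin] Lemma 1.5.3, Prop. 1.1.7, H.4/H.5; [GrossLMS1991] §3.
-/

set_option autoImplicit false

noncomputable section

open scoped NumberField
open NumberField IsDedekindDomain Field

namespace Literature.NumberTheory.GaloisCohomology.Howard2004

open Literature.NumberTheory.GaloisRepresentations
open Literature.NumberTheory.GaloisRepresentations.DiscreteGaloisModule
open Literature.NumberTheory.EllipticCurves

namespace DVRSetting

variable {p : ℕ} [Fact p.Prime] {K : Type} [Field K] [NumberField K]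
  {R : Type} [CommRing R] [IsDomain R] [IsDiscreteValuationRing R] [Algebra ℤ_[p] R]
  {N : ℕ → Type} [∀ k, AddCommGroup (N k)] [∀ k, TopologicalSpace (N k)]
  [∀ k, DiscreteTopology (N k)] [∀ k, Module R (N k)]
  {Rk : ℕ → Type} [∀ k, CommRing (Rk k)] [∀ k, IsLocalRing (Rk k)] [∀ k, TopologicalSpace (Rk k)]
  [∀ k, DiscreteTopology (Rk k)] [∀ k, Algebra ℤ_[p] (Rk k)] [∀ k, Algebra R (Rk k)]
  [∀ k, Module (Rk k) (N k)] [∀ k, IsScalarTower R (Rk k) (N k)]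
  {Nbar : Type} [AddCommGroup Nbar] [TopologicalSpace Nbar] [DiscreteTopology Nbar]
  [∀ k, Module (Rk k) Nbar]
  {Nq : ℕ → Finset (HeightOneSpectrum (𝓞 K)) → Type} [∀ k n, AddCommGroup (Nq k n)]
  [∀ k n, TopologicalSpace (Nq k n)] [∀ k n, DiscreteTopology (Nq k n)]
  [∀ k n, Module (Rk k) (Nq k n)] [∀ k n, Module R (Nq k n)]
  [∀ k n, IsScalarTower R (Rk k) (Nq k n)]

/-- **`ρ̄(τ⁻¹δ_vτ · δ_v) = 1` on `T̄` at an engine prime `v ∈ 𝓛^{(2k−1)}`**: the element `τ⁻¹δ_vτ · δ_v = σ̃_v²` lies in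
`res Γ_{K_v}` (`ConjugationDatum.conj_delta_mul_delta_mem_range_absGaloisRestrict`, `σ • v = v`), and `Γ_{K_v}` acts
trivially on `T̄` there. [cite: Howard2004HeegnerKolyvagin, §1.3 and §1.6 (arXiv p. 7 L44–48, p. 11 L33–38)] -/
theorem rhobar_conj_delta_mul_delta_apply (S : DVRSetting p K R N Rk Nbar Nq) (hy : S.SatisfiesH) {k : ℕ}
    {v : HeightOneSpectrum (𝓞 K)} (hv : v ∈ S.enginePrimes k) (x : Nbar) :
    S.ρbar (S.cd.conj (S.cd.δ v) * S.cd.δ v) x = x := by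
  have hσv : S.cd.σ • v = v := S.sigma_smul_eq_self_of_mem_L hy hv.1
  obtain ⟨g, hg⟩ := S.cd.conj_delta_mul_delta_mem_range_absGaloisRestrict hσv
  have hg' : absGaloisRestrict K (v.adicCompletion K) g = S.cd.conj (S.cd.δ v) * S.cd.δ v := hg
  rw [← hg']
  have hn : (↑({v} : Finset (HeightOneSpectrum (𝓞 K))) : Set (HeightOneSpectrum (𝓞 K))) ⊆ S.enginePrimes k := by
    intro w hw
    rw [Finset.coe_singleton, Set.mem_singleton_iff] at hw
    rw [hw]; exact hv
  exact S.toLocal_ρbar_apply_eq_self_of_subset_enginePrimes hy hn (Finset.mem_singleton_self v) g x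

/-- **The letter `hΘ` on a `DVRSetting`, for EVERY conjugation datum**: at every level `k` and every engine prime
`v ∈ 𝓛^{(2k−1)}`, `Θ_v = θ ∘ ρ̄(δ_v)` splits `T̄` into an H.5(a)-shaped pair of eigenvectors — VERBATIM the binder `hΘ` of
`ResidualTau.transverse_/unramified_eigen_decomposition_and_line` and `…_exists_eigenclass_ne_zero`
(`InertEigenlinesProofs`) at `(S.A k, S.ρbar, S.cd, v)`. [cite: Howard2004HeegnerKolyvagin, Lemma 1.5.3 proof (arXiv p. 10 L12–16) with H.4 / H.5 (p. 7 L69 – p. 8 L1)] -/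
theorem residual_hΘ (S : DVRSetting p K R N Rk Nbar Nq) (hy : S.SatisfiesH) {k : ℕ} {v : HeightOneSpectrum (𝓞 K)}
    (hv : v ∈ S.enginePrimes k) :
    ∃ xp : Nbar, xp ≠ 0 ∧ (S.A k).θ (S.ρbar (S.cd.δ v) xp) = xp ∧
      ∃ xm : Nbar, xm ≠ 0 ∧ (S.A k).θ (S.ρbar (S.cd.δ v) xm) = -xm ∧
        ∀ x : Nbar, ∃ a b : Rk k, x = a • xp + b • xm := by
  obtain ⟨Dbar, -, -, hθe⟩ := S.exists_residualDualityDatum hy k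
  exact ResidualTau.hΘ_of_duality (S.A k) (S.isScalarLinear_rhobar hy k) Dbar hθe (hy.h5a k)
    (fun a ha x => S.maximalIdeal_smul_residual_eq_zero hy k ha x) (S.isUnit_two hy k)
    (fun x => S.rhobar_conj_delta_mul_delta_apply hy hv x) (S.datum_hχ hy k v hv)

/-- **`σ₀`, `hcyc`, `hkill` at `T̄` for an engine prime** (`p ∤ #𝓞_K^×`): a tame generator `σ₀ ∈ I_{K_v}` with
`Γ_{K_v} = ⋃_j σ₀^j (Γ_{K_v} ∩ Γ_{K[ℓ]})` and `d • T̄ = 0` whenever `σ₀^d ∈ Γ_{K_v} ∩ Γ_{K[ℓ]}` (`#G_ℓ ∣ d`,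
`ℓ + 1 ∣ #G_ℓ · #𝓞_K^×`, `(ℓ+1)T̄ = 0`, `pT̄ = 0`). [cite: Howard2004HeegnerKolyvagin, §1.2 and Lemma 1.5.3 (arXiv p. 6 L84–95, p. 10 L12–16)] [cite: GrossLMS1991, §3] -/
theorem exists_sigma0_residual (S : DVRSetting p K R N Rk Nbar Nq) (hy : S.SatisfiesH)
    (hu : ¬ p ∣ Nat.card (𝓞 K)ˣ) {k : ℕ} {v : HeightOneSpectrum (𝓞 K)} (hv : v ∈ S.enginePrimes k) :
    ∃ σ₀ : absoluteGaloisGroup (v.adicCompletion K),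
      (∀ σ : absoluteGaloisGroup (v.adicCompletion K), ∃ j : ℕ,
        (σ₀ ^ j)⁻¹ * σ ∈ localRingClassSubgroup (residueChar v) S.jbar v) ∧
      ∀ d : ℕ, σ₀ ^ d ∈ localRingClassSubgroup (residueChar v) S.jbar v → ∀ t : Nbar, d • t = 0 := by
  have hK := hy.imagQuad
  have hℓ : (residueChar v).Prime := prime_residueChar v
  have hℓv : (residueChar v : 𝓞 K) ∈ v.asIdeal := natCast_residueChar_mem_asIdeal v
  have h0 : v ∈ Howard2004.degreeTwoPrimes p (S.T.ρ 0) := by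
    have h' := hy.L_subset hv.1
    rw [AdicTower.degreeTwoPrimes, Set.mem_iInter] at h'
    exact h' 0
  have hℓP : (Ideal.span {((residueChar v : ℕ) : 𝓞 K)}).IsPrime := isPrime_span_residueChar_of_isDegreeTwo hK.1 h0.1
  obtain ⟨σ₀, hσ₀⟩ := exists_isTameGenerator (F := v.adicCompletion K)
  have hGexp := fun g (hg : g ∈ ringClassGalOver (S.jbar.comp (algebraMap K (AlgebraicClosure K))) (residueChar v * 1) 1) =>
    pow_residueFieldCard_sub_one_eq_one_of_mem_ringClassGalOver_of_isImaginaryQuadratic hK _ hℓ hℓP hℓv hg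
  refine ⟨σ₀, fun σ => exists_pow_inv_mul_mem_localRingClassSubgroup_of_isTameGenerator hK S.jbar hℓ hℓP hℓv hσ₀
    hGexp σ, fun d hdm t => ?_⟩
  obtain ⟨c, hc⟩ := natCard_ringClassGalOver_dvd_of_pow_mem hK S.jbar hℓ hℓP hℓv hσ₀ hGexp hdm
  -- `(ℓ + 1) • T̄ = 0` from the level
  have hℓT : ∀ x : Nbar, (residueChar v + 1) • x = 0 := by
    intro x
    obtain ⟨y, rfl⟩ := (hy.h1 k).1.surjective x
    rw [← map_nsmul, S.residueChar_succ_smul_eq_zero_of_mem_levelPrimes hy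
      (S.enginePrimes_subset_levelPrimes hy k hv) y, map_zero]
  rw [hc, mul_comm, mul_smul, natCard_ringClassGalOver_smul_eq_zero_of_not_dvd_card_units p hK hu _ hℓ hℓP
    (fun x => ⟨1, by rw [pow_one]; exact S.p_nsmul_residual_eq_zero hy x⟩) hℓT t, smul_zero]

/-- The common local letters at an engine prime `v ∈ 𝓛^{(2k−1)}` (for `InertEigenlinesProofs` at `T̄`): `σ • v = v`,
trivial action of `Γ_{K_v}` on `T̄`, `Γ_{K_v} ∩ Γ_{K[ℓ]}` open and normal, `p T̄ = 0`, `𝔪 T̄ = 0`, no `2`-torsion, and the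
`R_k`- / `τ_v`-stability of `H¹_tr(K_v, T̄)`. Bundled as one statement to be destructured by the six letter theorems.
[cite: Howard2004HeegnerKolyvagin, §1.2–§1.3 and Lemma 1.5.3 (arXiv p. 6 L84–95, p. 7 L33–48, p. 10 L12–16)] -/
theorem residual_local_letters (S : DVRSetting p K R N Rk Nbar Nq) (hy : S.SatisfiesH) {k : ℕ}
    {v : HeightOneSpectrum (𝓞 K)} (hv : v ∈ S.enginePrimes k) :
    (∀ (σ : absoluteGaloisGroup (v.adicCompletion K)) (x : Nbar), GaloisRep.toLocal v S.ρbar σ x = x) ∧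
    IsOpen (localRingClassSubgroup (residueChar v) S.jbar v : Set (absoluteGaloisGroup (v.adicCompletion K))) ∧
    (localRingClassSubgroup (residueChar v) S.jbar v).Normal ∧
    (∀ x : Nbar, ∃ n : ℕ, p ^ n • x = 0) ∧
    (∀ a ∈ IsLocalRing.maximalIdeal (Rk k), ∀ x : Nbar, a • x = 0) ∧
    (∀ x : Nbar, 2 • x = 0 → x = 0) ∧
    (∀ (r : Rk k), ∀ x ∈ transverseCondition p S.ρbar (residueChar v) S.jbar v,
      galoisCohomology.scalarMapH1 (S.ρbar.toLocal (Sum.inr v))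
        (DualityDatum.isScalarLinear_toLocal (S.isScalarLinear_rhobar hy k) (Sum.inr v)) r x ∈
          transverseCondition p S.ρbar (residueChar v) S.jbar v) ∧
    (∀ x ∈ transverseCondition p S.ρbar (residueChar v) S.jbar v, (S.A k).thetaH1 (Sum.inr v) (S.cd.transportH1 S.ρbar v
        ((S.sigma_smul_eq_self_of_mem_L hy (S.enginePrimes_subset_L k hv)).symm ▸ x :
          galoisCohomology (S.ρbar.toLocal (Sum.inr (S.cd.σ • v))) 1)) ∈
        transverseCondition p S.ρbar (residueChar v) S.jbar v) := by
  have hK := hy.imagQuad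
  have hp : p.Prime := Fact.out
  have hℓ : (residueChar v).Prime := prime_residueChar v
  have hfix : S.cd.σ • v = v := S.sigma_smul_eq_self_of_mem_L hy (S.enginePrimes_subset_L k hv)
  have hn : (↑({v} : Finset (HeightOneSpectrum (𝓞 K))) : Set (HeightOneSpectrum (𝓞 K))) ⊆ S.enginePrimes k := by
    intro w hw
    rw [Finset.coe_singleton, Set.mem_singleton_iff] at hw
    rw [hw]; exact hv
  haveI := ringClassSubgroup_normal hK S.jbar hℓ.ne_zero
  refine ⟨fun σ x => S.toLocal_ρbar_apply_eq_self_of_subset_enginePrimes hy hn (Finset.mem_singleton_self v) σ x,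
    isOpen_localRingClassSubgroup hK S.jbar hℓ.ne_zero v, ?_, fun x => ⟨1, by rw [pow_one]; exact S.p_nsmul_residual_eq_zero hy x⟩,
    fun a ha x => S.maximalIdeal_smul_residual_eq_zero hy k ha x, ?_, ?_, ?_⟩
  · rw [localRingClassSubgroup]; infer_instance
  · intro x hx
    obtain ⟨u, hu⟩ := S.isUnit_two hy k
    have hx' : (2 : Rk k) • x = 0 := by rw [ofNat_smul_eq_nsmul]; exact hx
    have := congrArg (fun y => (↑u⁻¹ : Rk k) • y) hx'
    simpa [smul_smul, ← hu] using this
  · intro r x hx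
    exact isScalarStable_transverseStructure p (S.isScalarLinear_rhobar hy k) S.jbar (Sum.inr v) r hx
  · intro y hy'
    have hmem : (hfix.symm ▸ y : galoisCohomology (S.ρbar.toLocal (Sum.inr (S.cd.σ • v))) 1) ∈
        transverseStructure p S.ρbar S.jbar (Sum.inr (S.cd.σ • v)) := by
      have key : ∀ {w : HeightOneSpectrum (𝓞 K)} (e : v = w),
          (e ▸ y : galoisCohomology (S.ρbar.toLocal (Sum.inr w)) 1) ∈ transverseStructure p S.ρbar S.jbar (Sum.inr w) := by
        intro w e; subst e; exact hy'
      exact key hfix.symm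
    rw [transverseStructure_inr] at hmem
    have hch : ringChar (𝓞 K ⧸ (S.cd.σ • v).asIdeal) = ringChar (𝓞 K ⧸ v.asIdeal) := by rw [hfix]
    rw [hch] at hmem
    exact (S.A k).thetaH1_mem_transverseCondition _ S.jbar v
      (S.cd.transportH1_mem_transverseCondition_of_isImaginaryQuadratic hy.imagQuad S.ρbar S.jbar hℓ.ne_zero v hmem)

/-- **R6 letter `hdect`** (every datum): at an engine prime, every class of `H¹_tr(K_v, T̄)` is the sum of a `τ_v`-fixed
and a `τ_v`-anti-fixed transverse class. [cite: Howard2004HeegnerKolyvagin, Lemma 1.5.3 proof (arXiv p. 10 L12–16)] -/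
theorem residual_hdect (S : DVRSetting p K R N Rk Nbar Nq) (hy : S.SatisfiesH) (hu : ¬ p ∣ Nat.card (𝓞 K)ˣ)
    {k : ℕ} {v : HeightOneSpectrum (𝓞 K)} (hv : v ∈ S.enginePrimes k) :
    ∀ b ∈ transverseStructure p S.ρbar S.jbar (Sum.inr v), ∃ b₁ ∈ transverseStructure p S.ρbar S.jbar (Sum.inr v),
      ∃ b₂ ∈ transverseStructure p S.ρbar S.jbar (Sum.inr v),
        (S.A k).thetaH1 (Sum.inr v) (S.cd.transportH1 S.ρbar v
            ((S.sigma_smul_eq_self_of_mem_L hy (S.enginePrimes_subset_L k hv)).symm ▸ b₁ :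
              galoisCohomology (S.ρbar.toLocal (Sum.inr (S.cd.σ • v))) 1)) = b₁ ∧
          (S.A k).thetaH1 (Sum.inr v) (S.cd.transportH1 S.ρbar v
            ((S.sigma_smul_eq_self_of_mem_L hy (S.enginePrimes_subset_L k hv)).symm ▸ b₂ :
              galoisCohomology (S.ρbar.toLocal (Sum.inr (S.cd.σ • v))) 1)) = -b₂ ∧ b = b₁ + b₂ := by
  obtain ⟨htriv, hΛ, hΛn, hp', hm, h2, hLt, hstabt⟩ := S.residual_local_letters hy hv
  obtain ⟨σ₀, hcyc, hkill⟩ := S.exists_sigma0_residual hy hu hv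
  haveI := hΛn
  exact ((S.A k).transverse_eigen_decomposition_and_line (S.isScalarLinear_rhobar hy k)
    (S.sigma_smul_eq_self_of_mem_L hy (S.enginePrimes_subset_L k hv)) htriv (residueChar v) S.jbar hΛ hp' σ₀ hcyc
    hkill (S.datum_hdih hy _ (prime_residueChar v).ne_zero σ₀) (S.residual_hΘ hy hv) hm h2 hLt hstabt).1

/-- **R6 letter `hlinet`** (every datum): at an engine prime, each `τ_v`-eigenpart of `H¹_tr(K_v, T̄)` is a LINE.
[cite: Howard2004HeegnerKolyvagin, Lemma 1.5.3 proof (arXiv p. 10 L12–16)] -/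
theorem residual_hlinet (S : DVRSetting p K R N Rk Nbar Nq) (hy : S.SatisfiesH) (hu : ¬ p ∣ Nat.card (𝓞 K)ˣ)
    {k : ℕ} {v : HeightOneSpectrum (𝓞 K)} (hv : v ∈ S.enginePrimes k) :
    ∀ ε' : ℤ, ε' = 1 ∨ ε' = -1 → ∀ w ∈ transverseStructure p S.ρbar S.jbar (Sum.inr v),
      (S.A k).thetaH1 (Sum.inr v) (S.cd.transportH1 S.ρbar v
          ((S.sigma_smul_eq_self_of_mem_L hy (S.enginePrimes_subset_L k hv)).symm ▸ w :
            galoisCohomology (S.ρbar.toLocal (Sum.inr (S.cd.σ • v))) 1)) = ε' • w → w ≠ 0 →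
        ∀ b ∈ transverseStructure p S.ρbar S.jbar (Sum.inr v),
          (S.A k).thetaH1 (Sum.inr v) (S.cd.transportH1 S.ρbar v
              ((S.sigma_smul_eq_self_of_mem_L hy (S.enginePrimes_subset_L k hv)).symm ▸ b :
                galoisCohomology (S.ρbar.toLocal (Sum.inr (S.cd.σ • v))) 1)) = ε' • b →
          ∃ r : Rk k, b = galoisCohomology.scalarMapH1 (S.ρbar.toLocal (Sum.inr v))
            (DualityDatum.isScalarLinear_toLocal (S.isScalarLinear_rhobar hy k) (Sum.inr v)) r w := by
  obtain ⟨htriv, hΛ, hΛn, hp', hm, h2, hLt, hstabt⟩ := S.residual_local_letters hy hv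
  obtain ⟨σ₀, hcyc, hkill⟩ := S.exists_sigma0_residual hy hu hv
  haveI := hΛn
  exact ((S.A k).transverse_eigen_decomposition_and_line (S.isScalarLinear_rhobar hy k)
    (S.sigma_smul_eq_self_of_mem_L hy (S.enginePrimes_subset_L k hv)) htriv (residueChar v) S.jbar hΛ hp' σ₀ hcyc
    hkill (S.datum_hdih hy _ (prime_residueChar v).ne_zero σ₀) (S.residual_hΘ hy hv) hm h2 hLt hstabt).2

/-- **R6 letter `hwitt`** (every datum): at an engine prime, both `τ_v`-eigenparts of `H¹_tr(K_v, T̄)` are non-zero.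
[cite: Howard2004HeegnerKolyvagin, Lemma 1.5.3 proof (arXiv p. 10 L12–16)] -/
theorem residual_hwitt (S : DVRSetting p K R N Rk Nbar Nq) (hy : S.SatisfiesH) (hu : ¬ p ∣ Nat.card (𝓞 K)ˣ)
    {k : ℕ} {v : HeightOneSpectrum (𝓞 K)} (hv : v ∈ S.enginePrimes k) :
    ∀ ε' : ℤ, ε' = 1 ∨ ε' = -1 → ∃ w ∈ transverseStructure p S.ρbar S.jbar (Sum.inr v), w ≠ 0 ∧
      (S.A k).thetaH1 (Sum.inr v) (S.cd.transportH1 S.ρbar v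
          ((S.sigma_smul_eq_self_of_mem_L hy (S.enginePrimes_subset_L k hv)).symm ▸ w :
            galoisCohomology (S.ρbar.toLocal (Sum.inr (S.cd.σ • v))) 1)) = ε' • w := by
  intro ε hε
  obtain ⟨htriv, hΛ, hΛn, hp', hm, h2, hLt, hstabt⟩ := S.residual_local_letters hy hv
  obtain ⟨σ₀, hcyc, hkill⟩ := S.exists_sigma0_residual hy hu hv
  haveI := hΛn
  exact (S.A k).transverse_exists_eigenclass_ne_zero (S.sigma_smul_eq_self_of_mem_L hy (S.enginePrimes_subset_L k hv))
    (S.isScalarLinear_rhobar hy k) htriv (residueChar v) S.jbar hΛ hp' σ₀ hcyc hkill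
    (S.datum_hdih hy _ (prime_residueChar v).ne_zero σ₀) (S.residual_hΘ hy hv) hstabt hε

/-- **R6 letter `hdecf`** (every datum): at an engine prime, every class of `F̄ₖ(v) = H¹_ur(K_v, T̄)` is the sum of a
`τ_v`-fixed and a `τ_v`-anti-fixed class of `F̄ₖ(v)`. [cite: Howard2004HeegnerKolyvagin, Lemma 1.5.3 proof (arXiv p. 10 L12–16) and Prop. 1.1.7] -/
theorem residual_hdecf (S : DVRSetting p K R N Rk Nbar Nq) (hy : S.SatisfiesH)
    {k : ℕ} {v : HeightOneSpectrum (𝓞 K)} (hv : v ∈ S.enginePrimes k) :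
    ∀ b ∈ (hy.h1 k).1.propagateStructure (S.t k).cond (Sum.inr v),
      ∃ b₁ ∈ (hy.h1 k).1.propagateStructure (S.t k).cond (Sum.inr v),
        ∃ b₂ ∈ (hy.h1 k).1.propagateStructure (S.t k).cond (Sum.inr v),
          (S.A k).thetaH1 (Sum.inr v) (S.cd.transportH1 S.ρbar v
              ((S.sigma_smul_eq_self_of_mem_L hy (S.enginePrimes_subset_L k hv)).symm ▸ b₁ :
                galoisCohomology (S.ρbar.toLocal (Sum.inr (S.cd.σ • v))) 1)) = b₁ ∧
            (S.A k).thetaH1 (Sum.inr v) (S.cd.transportH1 S.ρbar v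
              ((S.sigma_smul_eq_self_of_mem_L hy (S.enginePrimes_subset_L k hv)).symm ▸ b₂ :
                galoisCohomology (S.ρbar.toLocal (Sum.inr (S.cd.σ • v))) 1)) = -b₂ ∧ b = b₁ + b₂ := by
  obtain ⟨htriv, -, -, -, hm, h2, -, -⟩ := S.residual_local_letters hy hv
  haveI : Finite Nbar := S.finite_residual hy
  have hfix := S.sigma_smul_eq_self_of_mem_L hy (S.enginePrimes_subset_L k hv)
  have hLf := S.propagateStructure_cond_inr_eq_unramifiedSubgroup_of_mem_L hy k (S.enginePrimes_subset_L k hv)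
  have hstabf : ∀ u ∈ unramifiedSubgroup (GaloisRep.toLocal v S.ρbar) 1, (S.A k).thetaH1 (Sum.inr v)
      (S.cd.transportH1 S.ρbar v ((S.sigma_smul_eq_self_of_mem_L hy (S.enginePrimes_subset_L k hv)).symm ▸ u :
        galoisCohomology (S.ρbar.toLocal (Sum.inr (S.cd.σ • v))) 1)) ∈ unramifiedSubgroup (GaloisRep.toLocal v S.ρbar) 1 := by
    intro u hu
    rw [← hLf] at hu ⊢
    refine (hy.h5b k v).le ⟨_, ?_, rfl⟩
    have key : ∀ {w : HeightOneSpectrum (𝓞 K)} (e : v = w),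
        (e ▸ u : galoisCohomology (S.ρbar.toLocal (Sum.inr w)) 1) ∈ (hy.h1 k).1.propagateStructure (S.t k).cond (Sum.inr w) := by
      intro w e; subst e; exact hu
    exact key hfix.symm
  obtain ⟨γ₀, hγ₀⟩ := exists_isFrobPow_holds (F := v.adicCompletion K) 1
  rw [hLf]
  exact ((S.A k).unramified_eigen_decomposition_and_line (S.isScalarLinear_rhobar hy k) hfix htriv γ₀ hγ₀
    (S.datum_hφγ hfix γ₀) (S.residual_hΘ hy hv) hm h2 hstabf).1

/-- **R6 letter `hlinef`** (every datum): at an engine prime, each `τ_v`-eigenpart of `F̄ₖ(v) = H¹_ur(K_v, T̄)` is a LINE.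
[cite: Howard2004HeegnerKolyvagin, Lemma 1.5.3 proof (arXiv p. 10 L12–16) and Prop. 1.1.7] -/
theorem residual_hlinef (S : DVRSetting p K R N Rk Nbar Nq) (hy : S.SatisfiesH)
    {k : ℕ} {v : HeightOneSpectrum (𝓞 K)} (hv : v ∈ S.enginePrimes k) :
    ∀ ε' : ℤ, ε' = 1 ∨ ε' = -1 → ∀ w ∈ (hy.h1 k).1.propagateStructure (S.t k).cond (Sum.inr v),
      (S.A k).thetaH1 (Sum.inr v) (S.cd.transportH1 S.ρbar v
          ((S.sigma_smul_eq_self_of_mem_L hy (S.enginePrimes_subset_L k hv)).symm ▸ w :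
            galoisCohomology (S.ρbar.toLocal (Sum.inr (S.cd.σ • v))) 1)) = ε' • w → w ≠ 0 →
        ∀ b ∈ (hy.h1 k).1.propagateStructure (S.t k).cond (Sum.inr v),
          (S.A k).thetaH1 (Sum.inr v) (S.cd.transportH1 S.ρbar v
              ((S.sigma_smul_eq_self_of_mem_L hy (S.enginePrimes_subset_L k hv)).symm ▸ b :
                galoisCohomology (S.ρbar.toLocal (Sum.inr (S.cd.σ • v))) 1)) = ε' • b →
          ∃ r : Rk k, b = galoisCohomology.scalarMapH1 (S.ρbar.toLocal (Sum.inr v))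
            (DualityDatum.isScalarLinear_toLocal (S.isScalarLinear_rhobar hy k) (Sum.inr v)) r w := by
  obtain ⟨htriv, -, -, -, hm, h2, -, -⟩ := S.residual_local_letters hy hv
  haveI : Finite Nbar := S.finite_residual hy
  have hfix := S.sigma_smul_eq_self_of_mem_L hy (S.enginePrimes_subset_L k hv)
  have hLf := S.propagateStructure_cond_inr_eq_unramifiedSubgroup_of_mem_L hy k (S.enginePrimes_subset_L k hv)
  have hstabf : ∀ u ∈ unramifiedSubgroup (GaloisRep.toLocal v S.ρbar) 1, (S.A k).thetaH1 (Sum.inr v)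
      (S.cd.transportH1 S.ρbar v ((S.sigma_smul_eq_self_of_mem_L hy (S.enginePrimes_subset_L k hv)).symm ▸ u :
        galoisCohomology (S.ρbar.toLocal (Sum.inr (S.cd.σ • v))) 1)) ∈ unramifiedSubgroup (GaloisRep.toLocal v S.ρbar) 1 := by
    intro u hu
    rw [← hLf] at hu ⊢
    refine (hy.h5b k v).le ⟨_, ?_, rfl⟩
    have key : ∀ {w : HeightOneSpectrum (𝓞 K)} (e : v = w),
        (e ▸ u : galoisCohomology (S.ρbar.toLocal (Sum.inr w)) 1) ∈ (hy.h1 k).1.propagateStructure (S.t k).cond (Sum.inr w) := by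
      intro w e; subst e; exact hu
    exact key hfix.symm
  obtain ⟨γ₀, hγ₀⟩ := exists_isFrobPow_holds (F := v.adicCompletion K) 1
  rw [hLf]
  exact ((S.A k).unramified_eigen_decomposition_and_line (S.isScalarLinear_rhobar hy k) hfix htriv γ₀ hγ₀
    (S.datum_hφγ hfix γ₀) (S.residual_hΘ hy hv) hm h2 hstabf).2

/-- **R6 letter `hwitf`** (every datum): at an engine prime, both `τ_v`-eigenparts of `F̄ₖ(v) = H¹_ur(K_v, T̄)` are non-zero.
[cite: Howard2004HeegnerKolyvagin, Lemma 1.5.3 proof (arXiv p. 10 L12–16) and Prop. 1.1.7] -/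
theorem residual_hwitf (S : DVRSetting p K R N Rk Nbar Nq) (hy : S.SatisfiesH)
    {k : ℕ} {v : HeightOneSpectrum (𝓞 K)} (hv : v ∈ S.enginePrimes k) :
    ∀ ε' : ℤ, ε' = 1 ∨ ε' = -1 → ∃ w ∈ (hy.h1 k).1.propagateStructure (S.t k).cond (Sum.inr v), w ≠ 0 ∧
      (S.A k).thetaH1 (Sum.inr v) (S.cd.transportH1 S.ρbar v
          ((S.sigma_smul_eq_self_of_mem_L hy (S.enginePrimes_subset_L k hv)).symm ▸ w :
            galoisCohomology (S.ρbar.toLocal (Sum.inr (S.cd.σ • v))) 1)) = ε' • w := by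
  intro ε hε
  obtain ⟨htriv, -, -, -, hm, h2, -, -⟩ := S.residual_local_letters hy hv
  haveI : Finite Nbar := S.finite_residual hy
  have hfix := S.sigma_smul_eq_self_of_mem_L hy (S.enginePrimes_subset_L k hv)
  have hLf := S.propagateStructure_cond_inr_eq_unramifiedSubgroup_of_mem_L hy k (S.enginePrimes_subset_L k hv)
  have hstabf : ∀ u ∈ unramifiedSubgroup (GaloisRep.toLocal v S.ρbar) 1, (S.A k).thetaH1 (Sum.inr v)
      (S.cd.transportH1 S.ρbar v ((S.sigma_smul_eq_self_of_mem_L hy (S.enginePrimes_subset_L k hv)).symm ▸ u :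
        galoisCohomology (S.ρbar.toLocal (Sum.inr (S.cd.σ • v))) 1)) ∈ unramifiedSubgroup (GaloisRep.toLocal v S.ρbar) 1 := by
    intro u hu
    rw [← hLf] at hu ⊢
    refine (hy.h5b k v).le ⟨_, ?_, rfl⟩
    have key : ∀ {w : HeightOneSpectrum (𝓞 K)} (e : v = w),
        (e ▸ u : galoisCohomology (S.ρbar.toLocal (Sum.inr w)) 1) ∈ (hy.h1 k).1.propagateStructure (S.t k).cond (Sum.inr w) := by
      intro w e; subst e; exact hu
    exact key hfix.symm
  obtain ⟨γ₀, hγ₀⟩ := exists_isFrobPow_holds (F := v.adicCompletion K) 1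
  rw [hLf]
  exact (S.A k).unramified_exists_eigenclass_ne_zero hfix (S.isScalarLinear_rhobar hy k) htriv γ₀ hγ₀
    (S.datum_hφγ hfix γ₀) (S.residual_hΘ hy hv) hstabf hε

/-- **The six R6 eigenline letters of the GD-line assembly, bundled** (every datum): at level `k`, for every engine
prime `v ∈ 𝓛^{(2k−1)}`, the letters `hdecf`, `hdect`, `hlinef`, `hlinet`, `hwitf`, `hwitt` of
`DVRSetting.engine_gd_dich_of_letters` (`DVRSettingEngineGDLineProofs`), VERBATIM in its binder shapes — the `τ_v = ±1`
eigen-decompositions of `F̄ₖ(v) = H¹_ur(K_v, T̄)` and of `H¹_tr(K_v, T̄)`, each eigenpart a non-zero LINE.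
[cite: Howard2004HeegnerKolyvagin, Lemma 1.5.3 proof (arXiv p. 10 L12–16), Prop. 1.1.7 and Prop. 1.1.9] -/
theorem residual_eigenline_letters (S : DVRSetting p K R N Rk Nbar Nq) (hy : S.SatisfiesH) (k : ℕ)
    (hu : ¬ p ∣ Nat.card (𝓞 K)ˣ) :
    (∀ (v : HeightOneSpectrum (𝓞 K)) (hv : v ∈ S.enginePrimes k), ∀ b ∈ (((hy.h1 k).1.propagateStructure (S.t k).cond) (Sum.inr v)), ∃ b₁ ∈ (((hy.h1 k).1.propagateStructure (S.t k).cond) (Sum.inr v)), ∃ b₂ ∈ (((hy.h1 k).1.propagateStructure (S.t k).cond) (Sum.inr v)),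
        (S.A k).thetaH1 (Sum.inr v) (S.cd.transportH1 S.ρbar v ((S.sigma_smul_eq_self_of_mem_L hy (S.enginePrimes_subset_L k hv)).symm ▸ b₁ : galoisCohomology (S.ρbar.toLocal (Sum.inr (S.cd.σ • v))) 1)) = b₁ ∧
        (S.A k).thetaH1 (Sum.inr v) (S.cd.transportH1 S.ρbar v ((S.sigma_smul_eq_self_of_mem_L hy (S.enginePrimes_subset_L k hv)).symm ▸ b₂ : galoisCohomology (S.ρbar.toLocal (Sum.inr (S.cd.σ • v))) 1)) = -b₂ ∧ b = b₁ + b₂) ∧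
    (∀ (v : HeightOneSpectrum (𝓞 K)) (hv : v ∈ S.enginePrimes k), ∀ b ∈ ((transverseStructure p S.ρbar S.jbar) (Sum.inr v)), ∃ b₁ ∈ ((transverseStructure p S.ρbar S.jbar) (Sum.inr v)), ∃ b₂ ∈ ((transverseStructure p S.ρbar S.jbar) (Sum.inr v)),
        (S.A k).thetaH1 (Sum.inr v) (S.cd.transportH1 S.ρbar v ((S.sigma_smul_eq_self_of_mem_L hy (S.enginePrimes_subset_L k hv)).symm ▸ b₁ : galoisCohomology (S.ρbar.toLocal (Sum.inr (S.cd.σ • v))) 1)) = b₁ ∧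
        (S.A k).thetaH1 (Sum.inr v) (S.cd.transportH1 S.ρbar v ((S.sigma_smul_eq_self_of_mem_L hy (S.enginePrimes_subset_L k hv)).symm ▸ b₂ : galoisCohomology (S.ρbar.toLocal (Sum.inr (S.cd.σ • v))) 1)) = -b₂ ∧ b = b₁ + b₂) ∧
    (∀ (v : HeightOneSpectrum (𝓞 K)) (hv : v ∈ S.enginePrimes k), ∀ ε' : ℤ, ε' = 1 ∨ ε' = -1 → ∀ w ∈ (((hy.h1 k).1.propagateStructure (S.t k).cond) (Sum.inr v)),
        (S.A k).thetaH1 (Sum.inr v) (S.cd.transportH1 S.ρbar v ((S.sigma_smul_eq_self_of_mem_L hy (S.enginePrimes_subset_L k hv)).symm ▸ w : galoisCohomology (S.ρbar.toLocal (Sum.inr (S.cd.σ • v))) 1)) = ε' • w → w ≠ 0 → ∀ b ∈ (((hy.h1 k).1.propagateStructure (S.t k).cond) (Sum.inr v)),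
        (S.A k).thetaH1 (Sum.inr v) (S.cd.transportH1 S.ρbar v ((S.sigma_smul_eq_self_of_mem_L hy (S.enginePrimes_subset_L k hv)).symm ▸ b : galoisCohomology (S.ρbar.toLocal (Sum.inr (S.cd.σ • v))) 1)) = ε' • b →
        ∃ r : Rk k, b = galoisCohomology.scalarMapH1 (S.ρbar.toLocal (Sum.inr v)) (DualityDatum.isScalarLinear_toLocal (S.isScalarLinear_rhobar hy k) (Sum.inr v)) r w) ∧
    (∀ (v : HeightOneSpectrum (𝓞 K)) (hv : v ∈ S.enginePrimes k), ∀ ε' : ℤ, ε' = 1 ∨ ε' = -1 → ∀ w ∈ ((transverseStructure p S.ρbar S.jbar) (Sum.inr v)),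
        (S.A k).thetaH1 (Sum.inr v) (S.cd.transportH1 S.ρbar v ((S.sigma_smul_eq_self_of_mem_L hy (S.enginePrimes_subset_L k hv)).symm ▸ w : galoisCohomology (S.ρbar.toLocal (Sum.inr (S.cd.σ • v))) 1)) = ε' • w → w ≠ 0 → ∀ b ∈ ((transverseStructure p S.ρbar S.jbar) (Sum.inr v)),
        (S.A k).thetaH1 (Sum.inr v) (S.cd.transportH1 S.ρbar v ((S.sigma_smul_eq_self_of_mem_L hy (S.enginePrimes_subset_L k hv)).symm ▸ b : galoisCohomology (S.ρbar.toLocal (Sum.inr (S.cd.σ • v))) 1)) = ε' • b →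
        ∃ r : Rk k, b = galoisCohomology.scalarMapH1 (S.ρbar.toLocal (Sum.inr v)) (DualityDatum.isScalarLinear_toLocal (S.isScalarLinear_rhobar hy k) (Sum.inr v)) r w) ∧
    (∀ (v : HeightOneSpectrum (𝓞 K)) (hv : v ∈ S.enginePrimes k), ∀ ε' : ℤ, ε' = 1 ∨ ε' = -1 → ∃ w ∈ (((hy.h1 k).1.propagateStructure (S.t k).cond) (Sum.inr v)), w ≠ 0 ∧
        (S.A k).thetaH1 (Sum.inr v) (S.cd.transportH1 S.ρbar v ((S.sigma_smul_eq_self_of_mem_L hy (S.enginePrimes_subset_L k hv)).symm ▸ w : galoisCohomology (S.ρbar.toLocal (Sum.inr (S.cd.σ • v))) 1)) = ε' • w) ∧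
    (∀ (v : HeightOneSpectrum (𝓞 K)) (hv : v ∈ S.enginePrimes k), ∀ ε' : ℤ, ε' = 1 ∨ ε' = -1 → ∃ w ∈ ((transverseStructure p S.ρbar S.jbar) (Sum.inr v)), w ≠ 0 ∧
        (S.A k).thetaH1 (Sum.inr v) (S.cd.transportH1 S.ρbar v ((S.sigma_smul_eq_self_of_mem_L hy (S.enginePrimes_subset_L k hv)).symm ▸ w : galoisCohomology (S.ρbar.toLocal (Sum.inr (S.cd.σ • v))) 1)) = ε' • w) :=
  ⟨fun _ hv => S.residual_hdecf hy hv, fun _ hv => S.residual_hdect hy hu hv, fun _ hv => S.residual_hlinef hy hv,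
    fun _ hv => S.residual_hlinet hy hu hv, fun _ hv => S.residual_hwitf hy hv, fun _ hv => S.residual_hwitt hy hu hv⟩

end DVRSetting

end Literature.NumberTheory.GaloisCohomology.Howard2004

end
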